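import Mathlib.Analysis.Calculus.BumpFunction.Convolution
import Mathlib.Analysis.Calculus.ContDiff.Convolution
import Literature.Analysis.FluidPDE.HarmonicProbe
import HarnessLib

/-!
# Mollified fields: derivatives, divergence and vorticity through the weak identities

Analysis/FluidPDE support file in the decomposition of `Literature.Analysis.FluidPDE.galdi_energy_equality`
(Galdi 2018, Thm. 1.1), step "weak vorticity in `L²` ⇒ weak gradient in `L²`". For a locally
integrable field `w : E → F` and a scalar test function `ρ` the mollification
`ρ ⋆ w = ∫ ρ(· − y) w(y) dy` (Mathlib's `MeasureTheory.convolution` with `lsmul`) is smooth (Mathlib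
`HasCompactSupport.contDiff_convolution_left`) with `D(ρ ⋆ w)(x) a = ∫ (Dρ(x − y) a) w(y) dy`; consequently the **weak** identities satisfied by `w`
become **pointwise** identities for `ρ ⋆ w`: `div (ρ ⋆ w) = 0` when `w` is weakly divergence
free, and the antisymmetric part of `D(ρ ⋆ w)` is `-(ρ ⋆ ω)` when `ω` is a weak vorticity of
`w` (`∫ ((Dφ a)⟪w, c⟫ − (Dφ c)⟪w, a⟫) = ∫ ω_{ac} φ` for all tests `φ`). Jensen's inequality for the
probability kernels `ρ(x − ·)` (`ρ ≥ 0`, `∫ ρ = 1`) bounds `‖ρ ⋆ f‖_{L²} ≤ ‖f‖_{L²}`,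
`‖ρ ⋆ k‖_{L⁴} ≤ ‖k‖_{L⁴}`, and for an approximate identity `ρₙ` the pairings
`∫ η (ρₙ ⋆ w) → ∫ η w` against scalar tests `η` (adjoint identity `∫ η (ρ ⋆ w) = ∫ (ρ ⋆ η) w` for
even `ρ`, dominated convergence). Standard (Evans, *PDE*, App. C.4, Thm. 6; Sohr 2001, Ch. II,
Lemma 1.7.x); everything here is proved from Mathlib's convolution library.

## Main results (all proved)

* `Fluid.fderiv_convolution_apply_eq`: `D(ρ ⋆ w)(x) a = ∫ (Dρ(x − y) a) • w y`.
* `Fluid.divergence_convolution_eq_zero`: `div (ρ ⋆ w) = 0` for weakly divergence-free `w`.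
* `Fluid.inner_fderiv_convolution_sub_eq`: spin entries of `D(ρ ⋆ w)` from a weak vorticity.
* `Fluid.sq_norm_convolution_le`, `Fluid.integral_sq_norm_convolution_le`,
  `Fluid.memLp_two_convolution`, `Fluid.memLp_four_convolution`: Jensen bounds.
* `Fluid.integral_smul_convolution_eq`: the adjoint identity; and
  `Fluid.tendsto_integral_smul_normed_convolution`: `∫ η • (ρₙ ⋆ w) → ∫ η • w` for bump
  sequences `ρₙ` with outer radius `→ 0`.

## References

* L. C. Evans, *Partial Differential Equations*, 2nd ed., AMS 2010, App. C.4 (mollifiers),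
  §5.2.1 (weak derivatives) (`Evans2010`).
* G. P. Galdi, *On the energy equality for distributional solutions to Navier–Stokes
  equations*, Proc. AMS 147 (2019), Thm. 1.1 (`Galdi2018`; the fact served).
-/

noncomputable section

open MeasureTheory TopologicalSpace Set Function Filter Topology InnerProductSpace Module Metric
  ContinuousLinearMap
open scoped RealInnerProductSpace ENNReal NNReal ContDiff Convolution Pointwise

namespace Literature.Analysis.FluidPDE

variable {E : Type*} [NormedAddCommGroup E] [InnerProductSpace ℝ E] [FiniteDimensional ℝ E]
  [MeasurableSpace E] [BorelSpace E]
variable {F : Type*} [NormedAddCommGroup F] [NormedSpace ℝ F] [CompleteSpace F]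

/-! ### Smoothness and the derivative of a mollified field -/

section Derivative

variable {ρ : E → ℝ} {w : E → F}

omit [CompleteSpace F] in
/-- **Derivative of a mollified field**: `D(ρ ⋆ w)(x) a = ∫ (Dρ(x − y) a) • w y` for `ρ ∈ C_c¹`
and locally integrable `w` (differentiation under the integral, Mathlib
`HasCompactSupport.hasFDerivAt_convolution_left`). [folklore] -/
theorem fderiv_convolution_apply_eq (hρ : ContDiff ℝ 1 ρ) (hρc : HasCompactSupport ρ)
    (hw : LocallyIntegrable w volume) (x a : E) :
    fderiv ℝ (ρ ⋆[lsmul ℝ ℝ, volume] w) x a = ∫ y, (fderiv ℝ ρ (x - y) a) • w y := by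
  rw [(hρc.hasFDerivAt_convolution_left (lsmul ℝ ℝ) hρ hw x).fderiv, convolution_eq_swap]
  have hex : ConvolutionExistsAt (fderiv ℝ ρ) w x ((lsmul ℝ ℝ).precompL E) volume :=
    (hρc.fderiv (𝕜 := ℝ)).convolutionExists_left _ (hρ.continuous_fderiv one_ne_zero) hw x
  rw [ContinuousLinearMap.integral_apply hex.integrable_swap]
  simp [precompL_apply, lsmul_apply]

omit [FiniteDimensional ℝ E] [MeasurableSpace E] [BorelSpace E] in
/-- The translated-reflected kernel `y ↦ ρ(x − y)` is a test function. [folklore] -/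
theorem isTestFunctionOn_comp_const_sub (hρ : ContDiff ℝ ∞ ρ) (hρc : HasCompactSupport ρ) (x : E) :
    FunctionSpaces.IsTestFunctionOn (⊤ : Opens E) fun y => ρ (x - y) where
  contDiff := hρ.comp (contDiff_const.sub contDiff_id)
  hasCompactSupport := hρc.comp_homeomorph (Homeomorph.subLeft x)
  tsupport_subset := fun _ _ => trivial

omit [FiniteDimensional ℝ E] [MeasurableSpace E] [BorelSpace E] in
/-- `D(ρ(x − ·))(y) a = -Dρ(x − y) a` (tree `NS.fderiv_comp_const_sub`; no differentiability
needed, unlike the accepted `Fluid.fderiv_comp_const_sub_apply` of `FluidPDE/HessianLaplacian`). [folklore] -/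
theorem fderiv_comp_const_sub_apply' (ρ : E → ℝ) (x y a : E) :
    fderiv ℝ (fun z => ρ (x - z)) y a = -fderiv ℝ ρ (x - y) a := by
  rw [FluidPDE.fderiv_comp_const_sub]; rfl

omit [CompleteSpace F] in
/-- Integrability of `y ↦ (Dρ(x − y) a) • w y` for `ρ ∈ C_c¹`, `w` locally integrable. [folklore] -/
theorem integrable_fderiv_comp_sub_smul (hρ : ContDiff ℝ 1 ρ) (hρc : HasCompactSupport ρ)
    (hw : LocallyIntegrable w volume) (x a : E) :
    Integrable (fun y => (fderiv ℝ ρ (x - y) a) • w y) volume := by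
  have hc : Continuous fun y => fderiv ℝ ρ (x - y) a :=
    ((hρ.continuous_fderiv one_ne_zero).comp (continuous_const.sub continuous_id)).clm_apply
      continuous_const
  have hcs : HasCompactSupport fun y => fderiv ℝ ρ (x - y) a :=
    (hρc.fderiv_apply (𝕜 := ℝ) a).comp_homeomorph (Homeomorph.subLeft x)
  exact hw.integrable_smul_left_of_hasCompactSupport hc hcs

omit [CompleteSpace F] in
/-- Integrability of `y ↦ ρ(x − y) • w y` for continuous compactly supported `ρ`, `w` locally
integrable. [folklore] -/
theorem integrable_comp_sub_smul (hρ : Continuous ρ) (hρc : HasCompactSupport ρ)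
    (hw : LocallyIntegrable w volume) (x : E) :
    Integrable (fun y => ρ (x - y) • w y) volume :=
  hw.integrable_smul_left_of_hasCompactSupport (hρ.comp (continuous_const.sub continuous_id))
    (hρc.comp_homeomorph (Homeomorph.subLeft x))

end Derivative

/-! ### Divergence and vorticity of the mollified field -/

section DivCurl

variable {ρ : E → ℝ} {w : E → E}

omit [FiniteDimensional ℝ E] [MeasurableSpace E] [BorelSpace E] in
/-- For a linear functional `ℓ` and an orthonormal basis `b`: `Σᵢ (ℓ bᵢ) ⟪w, bᵢ⟫ = ℓ w`. [folklore] -/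
theorem sum_apply_mul_inner_eq {ι : Type*} [Fintype ι] (b : OrthonormalBasis ι ℝ E)
    (ℓ : E →L[ℝ] ℝ) (w : E) : ∑ i, ℓ (b i) * ⟪w, b i⟫ = ℓ w := by
  conv_rhs => rw [← b.sum_repr' w, map_sum]
  refine Finset.sum_congr rfl fun i _ => ?_
  rw [map_smul, smul_eq_mul, real_inner_comm, mul_comm]

omit [MeasurableSpace E] [BorelSpace E] in
/-- `Dρ(z) w = ⟪w, ∇ρ(z)⟫`. [folklore] -/
theorem fderiv_apply_eq_inner_gradient (ρ : E → ℝ) (z w : E) :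
    fderiv ℝ ρ z w = ⟪w, gradient ρ z⟫ := by
  rw [gradient, real_inner_comm, InnerProductSpace.toDual_symm_apply]

/-- **`div (ρ ⋆ w) = 0` for weakly divergence-free `w`.** In a frame,
`div (ρ ⋆ w)(x) = Σᵢ ∫ (Dρ(x−y) bᵢ) ⟪w y, bᵢ⟫ dy = ∫ Dρ(x−y)(w y) dy = -∫ ⟪w, ∇(ρ(x − ·))⟫ = 0`,
the last by the weak divergence-free identity against the test function `ρ(x − ·)`. [folklore] -/
theorem divergence_convolution_eq_zero (hρ : ContDiff ℝ ∞ ρ) (hρc : HasCompactSupport ρ)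
    (hw : LocallyIntegrable w volume) (hdiv : IsWeaklyDivFree w) (x : E) :
    VectorCalculus.divergence (ρ ⋆[lsmul ℝ ℝ, volume] w) x = 0 := by
  set b := stdOrthonormalBasis ℝ E
  have hρ1 : ContDiff ℝ 1 ρ := hρ.of_le (by exact_mod_cast le_top)
  have hint := integrable_fderiv_comp_sub_smul hρ1 hρc hw x
  -- the weak identity against `ρ(x − ·)`
  have h0 := hdiv _ (isTestFunctionOn_comp_const_sub hρ hρc x)
  have hgrad : ∀ y, gradient (fun z => ρ (x - z)) y = -gradient ρ (x - y) := fun y => by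
    simp only [gradient, FluidPDE.fderiv_comp_const_sub, map_neg]
  simp_rw [hgrad, inner_neg_right, integral_neg, neg_eq_zero] at h0
  -- `div = Σᵢ ⟪bᵢ, D(ρ⋆w) bᵢ⟫ = ∫ Σᵢ (Dρ(x−y) bᵢ) ⟪w y, bᵢ⟫ = ∫ ⟪w y, ∇ρ(x−y)⟫`
  rw [divergence_eq_sum_inner_fderiv b]
  have h1 : ∀ i, ⟪b i, fderiv ℝ (ρ ⋆[lsmul ℝ ℝ, volume] w) x (b i)⟫ =
      ∫ y, fderiv ℝ ρ (x - y) (b i) * ⟪w y, b i⟫ := fun i => by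
    rw [fderiv_convolution_apply_eq hρ1 hρc hw, ← integral_inner (hint (b i))]
    refine integral_congr_ae (ae_of_all _ fun y => ?_)
    dsimp only
    rw [inner_smul_right, real_inner_comm]
  simp_rw [h1]
  rw [← integral_finsetSum _ fun i _ => ?_]
  · rw [← h0]
    refine integral_congr_ae (ae_of_all _ fun y => ?_)
    dsimp only
    rw [sum_apply_mul_inner_eq b, fderiv_apply_eq_inner_gradient]
  · exact ((hint (b i)).inner_const (b i)).congr (ae_of_all _ fun y => by
      simp only [inner_smul_left, RCLike.conj_to_real])

/-- **Spin entries of the mollified field from a weak vorticity.** If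
`∫ ((Dφ a)⟪w, c⟫ − (Dφ c)⟪w, a⟫) = ∫ ω φ` for every real test function `φ` (i.e. `ω` is the
weak `(a, c)`-vorticity of `w`), then
`⟪D(ρ ⋆ w)(x) a, c⟫ − ⟪D(ρ ⋆ w)(x) c, a⟫ = -(ρ ⋆ ω)(x)`: the left side is
`∫ ((Dρ(x−y) a)⟪w y, c⟫ − (Dρ(x−y) c)⟪w y, a⟫) dy = -∫ (curl-type test `ρ(x − ·)`) = -∫ ω ρ(x − ·)`. [folklore] -/
theorem inner_fderiv_convolution_sub_eq (hρ : ContDiff ℝ ∞ ρ) (hρc : HasCompactSupport ρ)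
    (hw : LocallyIntegrable w volume) {a c : E} {om : E → ℝ}
    (hom : ∀ φ : E → ℝ, FunctionSpaces.IsTestFunctionOn (⊤ : Opens E) φ →
      ∫ y, (fderiv ℝ φ y a * ⟪w y, c⟫ - fderiv ℝ φ y c * ⟪w y, a⟫) = ∫ y, om y * φ y) (x : E) :
    ⟪fderiv ℝ (ρ ⋆[lsmul ℝ ℝ, volume] w) x a, c⟫ - ⟪fderiv ℝ (ρ ⋆[lsmul ℝ ℝ, volume] w) x c, a⟫ =
      -(ρ ⋆[lsmul ℝ ℝ, volume] om) x := by
  have hρ1 : ContDiff ℝ 1 ρ := hρ.of_le (by exact_mod_cast le_top)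
  have hint := integrable_fderiv_comp_sub_smul hρ1 hρc hw x
  have h0 := hom _ (isTestFunctionOn_comp_const_sub hρ hρc x)
  simp_rw [fderiv_comp_const_sub_apply'] at h0
  rw [fderiv_convolution_apply_eq hρ1 hρc hw, fderiv_convolution_apply_eq hρ1 hρc hw,
    convolution_lsmul_swap]
  have h1 : ∀ a c : E, ⟪∫ y, (fderiv ℝ ρ (x - y) a) • w y, c⟫ =
      ∫ y, fderiv ℝ ρ (x - y) a * ⟪w y, c⟫ := fun a c => by
    rw [real_inner_comm, ← integral_inner (hint a)]
    refine integral_congr_ae (ae_of_all _ fun y => ?_)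
    dsimp only
    rw [inner_smul_right, real_inner_comm]
  have i1 : ∀ a c : E, Integrable (fun y => fderiv ℝ ρ (x - y) a * ⟪w y, c⟫) volume := fun a c =>
    ((hint a).inner_const c).congr (ae_of_all _ fun y => by
      simp only [inner_smul_left, RCLike.conj_to_real])
  rw [h1, h1, ← integral_sub (i1 a c) (i1 c a)]
  have h2 : ∫ y, (fderiv ℝ ρ (x - y) a * ⟪w y, c⟫ - fderiv ℝ ρ (x - y) c * ⟪w y, a⟫) =
      -∫ y, om y * ρ (x - y) := by
    rw [← h0, ← integral_neg]
    refine integral_congr_ae (ae_of_all _ fun y => ?_)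
    dsimp only
    ring
  rw [h2]
  congr 1
  refine integral_congr_ae (ae_of_all _ fun y => ?_)
  dsimp only
  rw [smul_eq_mul, mul_comm]

end DivCurl

/-! ### Jensen bounds for probability kernels -/

section Jensen

variable {ρ : E → ℝ}

/-- **Jensen / Cauchy–Schwarz for a probability density**: if `g ≥ 0`, `∫ g = 1`, then
`(∫ g a)² ≤ ∫ g a²` (expand `0 ≤ ∫ g (a − m)²` with `m = ∫ g a`). [folklore] -/
theorem sq_integral_mul_le {g a : E → ℝ} (hg0 : ∀ y, 0 ≤ g y) (hg1 : ∫ y, g y = 1)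
    (hg : Integrable g volume) (hga : Integrable (fun y => g y * a y) volume)
    (hga2 : Integrable (fun y => g y * a y ^ 2) volume) :
    (∫ y, g y * a y) ^ 2 ≤ ∫ y, g y * a y ^ 2 := by
  set m : ℝ := ∫ y, g y * a y
  have h0 : 0 ≤ ∫ y, g y * (a y - m) ^ 2 := integral_nonneg fun y => by
    exact mul_nonneg (hg0 y) (sq_nonneg _)
  have hexp : ∫ y, g y * (a y - m) ^ 2 = (∫ y, g y * a y ^ 2) - 2 * m * m + m ^ 2 * 1 := by
    have h1 : ∀ y, g y * (a y - m) ^ 2 = g y * a y ^ 2 - 2 * m * (g y * a y) + m ^ 2 * g y :=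
      fun y => by ring
    have i1 : Integrable (fun y => 2 * m * (g y * a y)) volume := hga.const_mul _
    have i2 : Integrable (fun y => g y * a y ^ 2 - 2 * m * (g y * a y)) volume := hga2.sub i1
    have i3 : Integrable (fun y => m ^ 2 * g y) volume := hg.const_mul _
    simp_rw [h1]
    rw [integral_add i2 i3, integral_sub hga2 i1, integral_const_mul, integral_const_mul, hg1]
  nlinarith

omit [CompleteSpace F] in
/-- Pointwise Jensen bound for the mollification: `‖(ρ ⋆ f)(x)‖² ≤ (ρ ⋆ ‖f‖²)(x)` for `ρ ≥ 0`,
`∫ ρ = 1`. [folklore] -/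
theorem sq_norm_convolution_le {f : E → F} (hρ : Continuous ρ) (hρc : HasCompactSupport ρ)
    (hρ0 : ∀ y, 0 ≤ ρ y) (hρ1 : ∫ y, ρ y = 1) (hf : LocallyIntegrable f volume)
    (hf2 : LocallyIntegrable (fun y => ‖f y‖ ^ 2) volume) (x : E) :
    ‖(ρ ⋆[lsmul ℝ ℝ, volume] f) x‖ ^ 2 ≤ (ρ ⋆[lsmul ℝ ℝ, volume] fun y => ‖f y‖ ^ 2) x := by
  rw [convolution_lsmul_swap, convolution_lsmul_swap]
  have hρx : Continuous fun y => ρ (x - y) := hρ.comp (continuous_const.sub continuous_id)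
  have hρxc : HasCompactSupport fun y => ρ (x - y) := hρc.comp_homeomorph (Homeomorph.subLeft x)
  have ig : Integrable (fun y => ρ (x - y)) volume := hρx.integrable_of_hasCompactSupport hρxc
  have hg1 : ∫ y, ρ (x - y) = 1 := by
    rw [show (fun y => ρ (x - y)) = fun y => ρ (x - y) from rfl]
    have := integral_sub_left_eq_self ρ volume x
    rw [this, hρ1]
  have hfn : LocallyIntegrable (fun y => ‖f y‖) volume :=
    hf.mono hf.aestronglyMeasurable.norm (ae_of_all _ fun y => by simp)
  have iga : Integrable (fun y => ρ (x - y) * ‖f y‖) volume :=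
    hfn.integrable_smul_left_of_hasCompactSupport hρx hρxc
  have iga2 : Integrable (fun y => ρ (x - y) * ‖f y‖ ^ 2) volume :=
    hf2.integrable_smul_left_of_hasCompactSupport hρx hρxc
  calc ‖∫ y, ρ (x - y) • f y‖ ^ 2 ≤ (∫ y, ‖ρ (x - y) • f y‖) ^ 2 :=
        pow_le_pow_left₀ (norm_nonneg _) (norm_integral_le_integral_norm _) 2
    _ = (∫ y, ρ (x - y) * ‖f y‖) ^ 2 := by
        congr 1
        exact integral_congr_ae (ae_of_all _ fun y => by
          dsimp only
          rw [norm_smul, Real.norm_of_nonneg (hρ0 _)])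
    _ ≤ ∫ y, ρ (x - y) * ‖f y‖ ^ 2 := sq_integral_mul_le (fun y => hρ0 _) hg1 ig iga iga2
    _ = ∫ y, ρ (x - y) • ‖f y‖ ^ 2 := by simp only [smul_eq_mul]

omit [CompleteSpace F] in
/-- **`L²` Jensen bound**: `∫ ‖(ρ ⋆ f)(x)‖² dx ≤ ∫ ‖f‖²` for `ρ ≥ 0`, `∫ ρ = 1`, `f ∈ L²`
(`∫ ρ ⋆ ‖f‖² = (∫ ρ)(∫ ‖f‖²)`, Mathlib `integral_convolution`), and `ρ ⋆ f ∈ L²`. [folklore] -/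
theorem memLp_two_convolution {f : E → F} (hρ : Continuous ρ) (hρc : HasCompactSupport ρ)
    (hρ0 : ∀ y, 0 ≤ ρ y) (hρ1 : ∫ y, ρ y = 1) (hf : MemLp f 2 volume) :
    MemLp (ρ ⋆[lsmul ℝ ℝ, volume] f) 2 volume ∧
      ∫ x, ‖(ρ ⋆[lsmul ℝ ℝ, volume] f) x‖ ^ 2 ≤ ∫ y, ‖f y‖ ^ 2 := by
  have hfl : LocallyIntegrable f volume := hf.locallyIntegrable one_le_two
  have hf2 : Integrable (fun y => ‖f y‖ ^ 2) volume := (memLp_two_iff_integrable_sq_norm hf.1).1 hf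
  have iρ : Integrable ρ volume := hρ.integrable_of_hasCompactSupport hρc
  have hpt := sq_norm_convolution_le hρ hρc hρ0 hρ1 hfl hf2.locallyIntegrable
  have hconv_c : Continuous (ρ ⋆[lsmul ℝ ℝ, volume] f) :=
    hρc.continuous_convolution_left _ hρ hfl
  have iconv2 : Integrable (ρ ⋆[lsmul ℝ ℝ, volume] fun y => ‖f y‖ ^ 2) volume :=
    iρ.integrable_convolution _ hf2
  have hint2 : ∫ x, (ρ ⋆[lsmul ℝ ℝ, volume] fun y => ‖f y‖ ^ 2) x = ∫ y, ‖f y‖ ^ 2 := by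
    rw [integral_convolution _ iρ hf2, lsmul_apply, hρ1, one_smul]
  have isq : Integrable (fun x => ‖(ρ ⋆[lsmul ℝ ℝ, volume] f) x‖ ^ 2) volume :=
    iconv2.mono' ((hconv_c.norm.pow 2).aestronglyMeasurable) (ae_of_all _ fun x => by
      rw [Real.norm_of_nonneg (sq_nonneg _)]; exact hpt x)
  refine ⟨(memLp_two_iff_integrable_sq_norm hconv_c.aestronglyMeasurable).2 isq, ?_⟩
  rw [← hint2]
  exact integral_mono isq iconv2 hpt

omit [CompleteSpace F] in
/-- **`L⁴` Jensen bound**: `ρ ⋆ k ∈ L⁴` with `∫ ‖ρ ⋆ k‖⁴ ≤ ∫ ‖k‖⁴` for `ρ ≥ 0`, `∫ ρ = 1`, `k ∈ L⁴`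
(Jensen twice: `(∫ρ|k|)⁴ ≤ (∫ρ|k|²)² ≤ ∫ρ|k|⁴`). [folklore] -/
theorem memLp_four_convolution {k : E → F} (hρ : Continuous ρ) (hρc : HasCompactSupport ρ)
    (hρ0 : ∀ y, 0 ≤ ρ y) (hρ1 : ∫ y, ρ y = 1) (hk : MemLp k 4 volume) :
    MemLp (ρ ⋆[lsmul ℝ ℝ, volume] k) 4 volume ∧
      ∫ x, ‖(ρ ⋆[lsmul ℝ ℝ, volume] k) x‖ ^ 4 ≤ ∫ y, ‖k y‖ ^ 4 := by
  have h14 : (1 : ℝ≥0∞) ≤ 4 := by norm_num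
  have hkl : LocallyIntegrable k volume := hk.locallyIntegrable h14
  have hk4 : Integrable (fun y => ‖k y‖ ^ 4) volume := by
    have hk' : MemLp k ((4 : ℕ) : ℝ≥0∞) volume := by simpa using hk
    exact hk'.integrable_norm_pow (by norm_num)
  -- `‖k‖²` is locally integrable: `‖k‖² ≤ 1 + ‖k‖⁴`
  have hk2l : LocallyIntegrable (fun y => ‖k y‖ ^ 2) volume := by
    refine ((locallyIntegrable_const (1 : ℝ)).add hk4.locallyIntegrable).mono
      (hk.1.norm.pow 2) (ae_of_all _ fun y => ?_)
    rw [Real.norm_of_nonneg (sq_nonneg _), Pi.add_apply, Real.norm_of_nonneg (by positivity)]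
    nlinarith [sq_nonneg (‖k y‖ ^ 2 - 1)]
  have iρ : Integrable ρ volume := hρ.integrable_of_hasCompactSupport hρc
  have hconv_c : Continuous (ρ ⋆[lsmul ℝ ℝ, volume] k) :=
    hρc.continuous_convolution_left _ hρ hkl
  -- pointwise: `‖ρ⋆k‖⁴ ≤ (ρ⋆‖k‖²)² ≤ ρ⋆‖k‖⁴`
  have hpt1 := sq_norm_convolution_le hρ hρc hρ0 hρ1 hkl hk2l
  have hpt2 : ∀ x, ((ρ ⋆[lsmul ℝ ℝ, volume] fun y => ‖k y‖ ^ 2) x) ^ 2 ≤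
      (ρ ⋆[lsmul ℝ ℝ, volume] fun y => ‖k y‖ ^ 4) x := by
    intro x
    have h4 : (fun y => ‖(fun y => ‖k y‖ ^ 2) y‖ ^ 2) = fun y => ‖k y‖ ^ 4 := by
      funext y; dsimp only; rw [Real.norm_of_nonneg (sq_nonneg _)]; ring
    have hk4l : LocallyIntegrable (fun y => ‖(fun y => ‖k y‖ ^ 2) y‖ ^ 2) volume := by
      rw [h4]; exact hk4.locallyIntegrable
    have h := sq_norm_convolution_le (F := ℝ) hρ hρc hρ0 hρ1 hk2l hk4l x
    rw [h4] at h
    refine le_trans (le_of_eq ?_) h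
    rw [Real.norm_of_nonneg]
    rw [convolution_lsmul_swap]
    exact integral_nonneg fun y => smul_nonneg (hρ0 _) (sq_nonneg _)
  have hpt : ∀ x, ‖(ρ ⋆[lsmul ℝ ℝ, volume] k) x‖ ^ 4 ≤ (ρ ⋆[lsmul ℝ ℝ, volume] fun y => ‖k y‖ ^ 4) x :=
    fun x => by
    calc ‖(ρ ⋆[lsmul ℝ ℝ, volume] k) x‖ ^ 4 = (‖(ρ ⋆[lsmul ℝ ℝ, volume] k) x‖ ^ 2) ^ 2 := by ring
      _ ≤ ((ρ ⋆[lsmul ℝ ℝ, volume] fun y => ‖k y‖ ^ 2) x) ^ 2 :=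
          pow_le_pow_left₀ (sq_nonneg _) (hpt1 x) 2
      _ ≤ (ρ ⋆[lsmul ℝ ℝ, volume] fun y => ‖k y‖ ^ 4) x := hpt2 x
  have iconv4 : Integrable (ρ ⋆[lsmul ℝ ℝ, volume] fun y => ‖k y‖ ^ 4) volume :=
    iρ.integrable_convolution _ hk4
  have hint4 : ∫ x, (ρ ⋆[lsmul ℝ ℝ, volume] fun y => ‖k y‖ ^ 4) x = ∫ y, ‖k y‖ ^ 4 := by
    rw [integral_convolution _ iρ hk4, lsmul_apply, hρ1, one_smul]
  have i4 : Integrable (fun x => ‖(ρ ⋆[lsmul ℝ ℝ, volume] k) x‖ ^ 4) volume :=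
    iconv4.mono' ((hconv_c.norm.pow 4).aestronglyMeasurable) (ae_of_all _ fun x => by
      rw [Real.norm_of_nonneg (by positivity)]; exact hpt x)
  refine ⟨?_, ?_⟩
  · have h4 : (4 : ℝ≥0∞) ≠ 0 := by norm_num
    have h4' : (4 : ℝ≥0∞) ≠ (⊤ : ℝ≥0∞) := by norm_num
    refine (integrable_norm_rpow_iff hconv_c.aestronglyMeasurable h4 h4').1 ?_
    refine i4.congr (ae_of_all _ fun x => ?_)
    dsimp only
    rw [ENNReal.toReal_ofNat, show (4 : ℝ) = ((4 : ℕ) : ℝ) by norm_num, Real.rpow_natCast]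
  · rw [← hint4]
    exact integral_mono i4 iconv4 hpt

end Jensen

/-! ### The adjoint identity and convergence of the pairings -/

section Pairing

variable {ρ : E → ℝ} {w : E → F}

omit [CompleteSpace F] in
/-- Sup bound for the mollification of a bounded function by a probability kernel:
`‖(ρ ⋆ η)(y)‖ ≤ M` if `‖η‖ ≤ M`, `ρ ≥ 0`, `∫ ρ = 1`. [folklore] -/
theorem norm_convolution_le_of_norm_le {η : E → F} (hρ : Continuous ρ) (hρc : HasCompactSupport ρ)
    (hρ0 : ∀ y, 0 ≤ ρ y) (hρ1 : ∫ y, ρ y = 1) {M : ℝ}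
    (hM : ∀ t, ‖η t‖ ≤ M) (y : E) : ‖(ρ ⋆[lsmul ℝ ℝ, volume] η) y‖ ≤ M := by
  rw [convolution_lsmul_swap]
  have hρy : Continuous fun t => ρ (y - t) := hρ.comp (continuous_const.sub continuous_id)
  have hρyc : HasCompactSupport fun t => ρ (y - t) := hρc.comp_homeomorph (Homeomorph.subLeft y)
  have ig : Integrable (fun t => ρ (y - t)) volume := hρy.integrable_of_hasCompactSupport hρyc
  have hg1 : ∫ t, ρ (y - t) = 1 := by rw [integral_sub_left_eq_self ρ volume y, hρ1]
  calc ‖∫ t, ρ (y - t) • η t‖ ≤ ∫ t, ρ (y - t) * M := by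
        refine norm_integral_le_of_norm_le (ig.mul_const M) (ae_of_all _ fun t => ?_)
        rw [norm_smul, Real.norm_of_nonneg (hρ0 _)]
        exact mul_le_mul_of_nonneg_left (hM t) (hρ0 _)
    _ = M := by rw [integral_mul_const, hg1, one_mul]

omit [CompleteSpace F] in
/-- Support of the mollification: `(ρ ⋆ η)(y) ≠ 0 ⇒ y ∈ tsupport η + tsupport ρ`. [folklore] -/
theorem convolution_eq_zero_of_notMem {η : E → F} {y : E}
    (hy : y ∉ tsupport η + tsupport ρ) : (ρ ⋆[lsmul ℝ ℝ, volume] η) y = 0 := by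
  rw [convolution_lsmul_swap]
  refine integral_eq_zero_of_ae (ae_of_all _ fun t => ?_)
  by_cases ht : t ∈ tsupport η
  · have hρt : ρ (y - t) = 0 := by
      by_contra h
      exact hy ⟨t, ht, y - t, subset_tsupport _ h, by abel⟩
    simp [hρt]
  · simp [image_eq_zero_of_notMem_tsupport ht]

/-- **The adjoint identity** `∫ η(x) • (ρ ⋆ w)(x) dx = ∫ (ρ ⋆ η)(y) • w(y) dy` for an even kernel
`ρ ∈ C_c`, a weight `η ∈ C_c` and a locally integrable field `w` (Fubini on the compact set
`tsupport η × (tsupport η − tsupport ρ)`). [folklore] -/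
theorem integral_smul_convolution_eq {η : E → ℝ} (hρ : Continuous ρ) (hρc : HasCompactSupport ρ)
    (hρe : ∀ y, ρ (-y) = ρ y) (hη : Continuous η) (hηc : HasCompactSupport η)
    (hw : LocallyIntegrable w volume) :
    ∫ x, η x • (ρ ⋆[lsmul ℝ ℝ, volume] w) x = ∫ y, (ρ ⋆[lsmul ℝ ℝ, volume] η) y • w y := by
  -- the two-variable integrand and its integrable majorant
  set H : E → E → F := fun x y => (η x * ρ (x - y)) • w y with hHdef
  obtain ⟨C, hC⟩ := hρ.bounded_above_of_compact_support hρc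
  have hC0 : 0 ≤ C := (norm_nonneg _).trans (hC 0)
  set K : Set E := tsupport η + -tsupport ρ with hKdef
  have hK : IsCompact K := hηc.isCompact.add hρc.isCompact.neg
  have iη : Integrable (fun x => ‖η x‖ * C) volume :=
    (hη.norm.mul continuous_const).integrable_of_hasCompactSupport (hηc.norm.mul_right)
  have iwK : Integrable (fun y => K.indicator (fun y => ‖w y‖) y) volume := by
    rw [integrable_indicator_iff hK.measurableSet]
    exact (hw.integrableOn_isCompact hK).norm
  have hmaj : ∀ x y, ‖H x y‖ ≤ ‖η x‖ * C * K.indicator (fun y => ‖w y‖) y := by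
    intro x y
    rw [hHdef]; dsimp only
    by_cases hρxy : ρ (x - y) = 0
    · rw [hρxy, mul_zero, zero_smul, norm_zero]
      exact mul_nonneg (mul_nonneg (norm_nonneg _) hC0) (indicator_nonneg (fun _ _ => norm_nonneg _) _)
    by_cases hηx : η x = 0
    · rw [hηx, zero_mul, zero_smul, norm_zero, norm_zero, zero_mul, zero_mul]
      -- goal closed
    have hyK : y ∈ K := by
      refine ⟨x, subset_tsupport _ hηx, -(x - y), ?_, by abel⟩
      exact neg_mem_neg.2 (subset_tsupport _ hρxy)
    rw [indicator_of_mem hyK, norm_smul, norm_mul]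
    have := hC (x - y)
    have h1 : ‖η x‖ * ‖ρ (x - y)‖ ≤ ‖η x‖ * C := mul_le_mul_of_nonneg_left this (norm_nonneg _)
    exact mul_le_mul_of_nonneg_right h1 (norm_nonneg _)
  have hHm : AEStronglyMeasurable (uncurry H) (volume.prod volume) := by
    refine AEStronglyMeasurable.smul ?_ hw.aestronglyMeasurable.comp_snd
    exact ((hη.comp continuous_fst).mul (hρ.comp (continuous_fst.sub continuous_snd)))
      |>.aestronglyMeasurable
  have hHi : Integrable (uncurry H) (volume.prod volume) := by
    refine (iη.mul_prod iwK).mono' hHm (ae_of_all _ fun p => ?_)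
    exact hmaj p.1 p.2
  -- left side as an iterated integral
  have hL : ∫ x, η x • (ρ ⋆[lsmul ℝ ℝ, volume] w) x = ∫ x, ∫ y, H x y := by
    refine integral_congr_ae (ae_of_all _ fun x => ?_)
    dsimp only
    rw [convolution_lsmul_swap, ← integral_smul]
    refine integral_congr_ae (ae_of_all _ fun y => ?_)
    rw [hHdef]; dsimp only
    rw [mul_smul]
  -- right side as the swapped iterated integral
  have hR : ∫ y, (ρ ⋆[lsmul ℝ ℝ, volume] η) y • w y = ∫ y, ∫ x, H x y := by
    refine integral_congr_ae (ae_of_all _ fun y => ?_)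
    dsimp only
    rw [convolution_lsmul_swap, ← integral_smul_const]
    refine integral_congr_ae (ae_of_all _ fun x => ?_)
    rw [hHdef]; dsimp only
    rw [smul_eq_mul, mul_comm (ρ (y - x)), ← neg_sub x y, hρe]
  rw [hL, hR]
  exact integral_integral_swap hHi

/-- **Convergence of the pairings for an approximate identity.** For a family of bump functions
`φᵢ` with outer radius `→ 0`, a weight `η ∈ C_c` and a locally integrable field `w`:
`∫ η • (φᵢ ⋆ w) → ∫ η • w` (adjoint identity, `φᵢ ⋆ η → η` pointwise with a common compact
support and a common sup bound, dominated convergence). [folklore] -/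
theorem tendsto_integral_smul_normed_convolution {ι : Type*} {φ : ι → ContDiffBump (0 : E)}
    {l : Filter ι} [l.IsCountablyGenerated] (hφ : Tendsto (fun i => (φ i).rOut) l (𝓝 0))
    {η : E → ℝ} (hη : Continuous η) (hηc : HasCompactSupport η) (hw : LocallyIntegrable w volume) :
    Tendsto (fun i => ∫ x, η x • ((φ i).normed volume ⋆[lsmul ℝ ℝ, volume] w) x) l
      (𝓝 (∫ x, η x • w x)) := by
  have hρ : ∀ i, Continuous ((φ i).normed volume) := fun i => (φ i).continuous_normed
  have hρc : ∀ i, HasCompactSupport ((φ i).normed volume) := fun i =>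
    (φ i).hasCompactSupport_normed
  have hρ0 : ∀ i y, 0 ≤ (φ i).normed volume y := fun i y => (φ i).nonneg_normed y
  have hρ1 : ∀ i, ∫ y, (φ i).normed volume y = 1 := fun i => (φ i).integral_normed
  have hρe : ∀ i y, (φ i).normed volume (-y) = (φ i).normed volume y := fun i y =>
    (φ i).normed_neg y
  have hadj : ∀ i, ∫ x, η x • ((φ i).normed volume ⋆[lsmul ℝ ℝ, volume] w) x =
      ∫ y, ((φ i).normed volume ⋆[lsmul ℝ ℝ, volume] η) y • w y := fun i =>
    integral_smul_convolution_eq (hρ i) (hρc i) (hρe i) hη hηc hw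
  simp_rw [hadj]
  -- dominated convergence
  obtain ⟨M, hM⟩ := hη.bounded_above_of_compact_support hηc
  set K : Set E := tsupport η + closedBall (0 : E) 1 with hKdef
  have hK : IsCompact K := hηc.isCompact.add (isCompact_closedBall 0 1)
  have hηl : LocallyIntegrable η volume := hη.locallyIntegrable
  have hsmall : ∀ᶠ i in l, (φ i).rOut < 1 := (tendsto_order.1 hφ).2 1 one_pos
  refine tendsto_integral_filter_of_dominated_convergence
    (fun y => M * K.indicator (fun y => ‖w y‖) y) ?_ ?_ ?_ ?_
  · exact Eventually.of_forall fun i =>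
      (((hρc i).continuous_convolution_left _ (hρ i) hηl).aestronglyMeasurable).smul
        hw.aestronglyMeasurable
  · filter_upwards [hsmall] with i hi
    refine ae_of_all _ fun y => ?_
    by_cases hyK : y ∈ K
    · rw [indicator_of_mem hyK, norm_smul]
      exact mul_le_mul_of_nonneg_right
        (norm_convolution_le_of_norm_le (hρ i) (hρc i) (hρ0 i) (hρ1 i) hM y) (norm_nonneg _)
    · have h0 : ((φ i).normed volume ⋆[lsmul ℝ ℝ, volume] η) y = 0 := by
        refine convolution_eq_zero_of_notMem fun hy => hyK ?_
        rw [(φ i).tsupport_normed_eq] at hy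
        obtain ⟨a, ha, b, hb, rfl⟩ := hy
        exact ⟨a, ha, b, closedBall_subset_closedBall hi.le hb, rfl⟩
      rw [h0, zero_smul, norm_zero, indicator_of_notMem hyK, mul_zero]
  · rw [show (fun y => M * K.indicator (fun y => ‖w y‖) y) =
        fun y => M * K.indicator (fun y => ‖w y‖) y from rfl]
    refine Integrable.const_mul ?_ M
    rw [integrable_indicator_iff hK.measurableSet]
    exact (hw.integrableOn_isCompact hK).norm
  · exact ae_of_all _ fun y =>
      ((ContDiffBump.convolution_tendsto_right_of_continuous hφ hη y).smul_const (w y))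

end Pairing

end Literature.Analysis.FluidPDE
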